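import Summits.QuantumFields.YangMills.Theorems.BalabanLadderROTBridgeOnClass
import Summits.QuantumFields.YangMills.Theorems.BalabanLadderUVSeamRecStubTransport
import HarnessLib

/-!
# Route `BalabanLadder` — CYCLE-FREE pieces of the deciding theorem `closes` (the R85 batch shape, 7 binders)

OS-ASSEMBLY BOOKKEEPING (cell `ym-fleet`, seat `ym-osasm-p2`, director-ym R136 (iii); `--supports stmt-QuantumFields-19356`).  PURE THEOREMS,
count-neutral; nothing of Bałaban's programme, no seam, no residual is discharged; not a gap, not Clay.

WHY THIS FILE EXISTS (D-0027 §2.1 + `lint.import-cycle`).  A route's deciding theorem is rendered VERBATIM INTO the route file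
`Theses/BalabanLadder.lean` and «elaborates with this file»: it may cite only declarations of modules the route file imports, and a module that
(transitively) imports the route file can never be added to those imports.  Every tree theorem the owner's pre-certified R85 glue
(`pub/ym-beyond/p2-g21-files/R85_closes_preview_g21.lean` 68192367c88e2d7d, `closes_R85'`) is built from lives in such a module:
the legs-witness transport `Theorems.UVOtherGroups.legsWitness_of_continuousMulEquiv` (`…UVOtherGroupsSUN`, which imports `…UVOtherGroupsDefs` →
`…BalabanUVNodesClustersCore` → the route file), the unit-of-record facts `Cruxes.UVSeamRec.UnitTransfer.uRec_pos ∕ tendsto_uRec`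
(`…UVSeamRecUnitTransfer` → the route file) — which is why today's `closes` carries a 40-line inline asymptotics block — and the rev-2 ∕ rev-2′
monotonicity lemmas (`…ROTGuardIR`, `…ROTOnClassKing` → the route file).  This module re-proves exactly those pieces over imports whose closure
is `Theses`-free (`…ROTBridgeOnClass`: 883 modules, no `Theses`; `…UVSeamRecStubTransport`: 105 modules, no `Theses`), so that the route file CAN
import it and the batch `closes` becomes a three-line composition BY NAME (farm-checked paste mock: seat folder `work/R85_routefile_paste.lean`,
desk `pub/ym-fleet/ym-osasm-p2/`).  It states NO route decl (it cannot see them): every hypothesis below is the TEXT of an item — the route decl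
unfolds to it definitionally at the call site (`hIR : IR`, `hROT : ROT` after the rev-2′ restate = `Theorems.ROT.ROTRev2'` character-identical,
`hNon : UVNonSUNRec`, …).

* §1 the unit of record `uRec β = exp (sizeLog β 1)` (`Cruxes.UVSeamRec.Transport.uRec`, the cycle-free abbreviation; reducibly the literal
  `fun β => Real.exp (sizeLog β 1)` of the text of `UVSeamRec`): positive, `→ 0` (`uRec_pos`, `tendsto_uRec`).  Fourth copy of this folklore
  computation in the tree — the only one a route file can import (the three landed copies live in modules importing a route file, so the
  gate's `dedup.landed` advice «import and reuse» cannot be followed here; by-name duplicates are kept private ∕ inlined).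
* §2 D0 Haar transport of a legs witness along `e : G ≃ₜ* H` (private `legsWitness_pull`, inlined for the same reason; the public lemma is
  `Theorems.UVOtherGroups.legsWitness_of_continuousMulEquiv`).
* §3 CLASS ASSEMBLY from the three R85 pieces as TEXTS: the `SU(2)`-class piece in record form at `uRec` (what `hSeam hUV` yields), the
  `SU(N)`-class witnesses `N ≥ 3` (what `hWit N hN (hApex N hN)` yields) and the non-`SU(N)` record residual (`hNon` verbatim) give the bridge's
  UV-side input on EVERY compact simple `G` (`legsWitnessAll_of_pieces`; trichotomy by `Nonempty (G ≃ₜ* SU(2))` ∕ `∃ N ≥ 2, Nonempty (G ≃ₜ* SU(N))`).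
* §4 CLOSERS: bridge input + the infrared leg (text of `IR`) + the rotation leg ⊢ `_root_.YangMills` — for `ROT` rev 2′ OF RECORD
  (`Theorems.ROT.ROTRev2'`, via the PROVED class bridge `Theorems.ROT.bridgeOnClass` ∕ `yangMills_of_legs_on`) and for rev 1 (today's text
  `Theorems.ROT.ROTRev1`, via `Y2Bridge.yangMills_of_legs`); and the seven-binder compositions `yangMills_of_pieces_rotRev2'` (= the owner's
  `closes_R85'` modulo two lambdas) ∕ `yangMills_of_pieces_rotRev1`.

Refs: owner batch `pub/ym-beyond/p2-g21-files/R85-BATCH-EDITS.md` rev 3e (items 1–3, §5b importer census); Bröcker–tom Dieck 1985 III (4.1)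
(pull-back of representations); folklore (Haar transport; `log β = o(β)`).
-/

set_option autoImplicit false

noncomputable section

open MeasureTheory Filter Topology
open Literature.MathematicalPhysics.QuantumFieldTheory Literature.MathematicalPhysics.QuantumLattice
open Summit.QuantumFields.YangMills.Cruxes.OSLegsFromFemtoAndGap.DlrCollarTransfer
open Summit.QuantumFields.YangMills.Cruxes.UVSeamRec.Transport (pull lowerBounds_pull_iff momentBounds6_pull_iff uRec)
open Summit.QuantumFields.YangMills.Theorems.ROT (UnboundedClass LatticeRotWardOn ROTRev1 ROTRev2' bridgeOnClass yangMills_of_legs_on)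

namespace Summit.QuantumFields.YangMills.Theorems.BalabanLadderGlue

/-! ## §1 The unit of record -/

/-- The unit of record `uRec β = exp (sizeLog β 1)` is positive. [folklore] -/
theorem uRec_pos (β : ℝ) : 0 < uRec β := Real.exp_pos _

/-- The unit of record tends to `0` as `β → ∞`: the two-loop size label `sizeLog β 1 = −β/(4b₀) − (b₁/(2b₀²))·log(2b₀/β)` tends to `−∞`
(the linear term beats the logarithm, `log β = o(β)`), and `exp` of it to `0`.  Cycle-free copy of
`Cruxes.UVSeamRec.UnitTransfer.tendsto_uRec` (that module imports the route file). [folklore] -/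
theorem tendsto_uRec : Tendsto uRec atTop (𝓝 0) := by
  have hsl : Tendsto (fun β : ℝ => Summit.QuantumFields.YangMills.Theorems.FemtoTransferGap.sizeLog β 1) atTop atBot := by
    have hb0 : (0 : ℝ) < Summit.QuantumFields.YangMills.Theorems.FemtoTransferGap.b0 := by
      unfold Summit.QuantumFields.YangMills.Theorems.FemtoTransferGap.b0; positivity
    set B0 : ℝ := Summit.QuantumFields.YangMills.Theorems.FemtoTransferGap.b0 with hB0
    set K : ℝ := Summit.QuantumFields.YangMills.Theorems.FemtoTransferGap.b1 / (2 * B0 ^ 2) with hK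
    have h4 : (0 : ℝ) < 4 * B0 := by positivity
    have hf : Tendsto (fun β : ℝ => -(β / (4 * B0))) atTop atBot :=
      tendsto_neg_atTop_atBot.comp (tendsto_id.atTop_div_const h4)
    have hg : (fun β : ℝ => K * Real.log β - K * Real.log (2 * B0)) =o[atTop] (fun β : ℝ => -(β / (4 * B0))) := by
      have h1 : (fun β : ℝ => K * Real.log β - K * Real.log (2 * B0)) =o[atTop] (fun β : ℝ => β) := by
        have hlog : (fun β : ℝ => K * Real.log β) =o[atTop] (fun β : ℝ => β) :=
          Real.isLittleO_log_id_atTop.const_mul_left K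
        have hc : (fun _ : ℝ => K * Real.log (2 * B0)) =o[atTop] (fun β : ℝ => β) :=
          Asymptotics.isLittleO_const_left.2
            (Or.inr (show Tendsto (fun β : ℝ => ‖β‖) atTop atTop from tendsto_norm_atTop_atTop))
        exact hlog.sub hc
      have h2 : (fun β : ℝ => β) =O[atTop] (fun β : ℝ => -(β / (4 * B0))) := by
        refine Asymptotics.IsBigO.of_bound (4 * B0) (Eventually.of_forall fun β => ?_)
        rw [norm_neg, norm_div, Real.norm_of_nonneg h4.le, mul_div_cancel₀ _ h4.ne']
      exact h1.trans_isBigO h2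
    have hsum : Tendsto ((fun β : ℝ => -(β / (4 * B0))) + fun β : ℝ => K * Real.log β - K * Real.log (2 * B0))
        atTop atBot :=
      ((Asymptotics.IsEquivalent.refl.add_isLittleO hg).symm).tendsto_atBot hf
    refine hsum.congr' ?_
    filter_upwards [eventually_gt_atTop (0 : ℝ)] with β hβ
    simp only [Pi.add_apply, Summit.QuantumFields.YangMills.Theorems.FemtoTransferGap.sizeLog, hK, hB0, Nat.cast_one,
      Real.log_one]
    rw [Real.log_div (mul_pos two_pos hb0).ne' hβ.ne']
    ring
  exact Real.tendsto_exp_atBot.comp hsl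

/-! ## §2 D0 Haar transport of a legs witness (inlined: the by-name lemma lives in `…UVOtherGroupsSUN` §6, not importable here) -/

section Transport

variable {G H : Type} [Group G] [TopologicalSpace G] [IsTopologicalGroup G] [CompactSpace G]
  [MeasurableSpace G] [BorelSpace G]
  [Group H] [TopologicalSpace H] [IsTopologicalGroup H] [CompactSpace H]
  [MeasurableSpace H] [BorelSpace H]

/-- D0 iso-transport of a legs witness along `e : G ≃ₜ* H` (representation `pull e r = r ∘ e`; `lowerBounds_pull_iff`,
`momentBounds6_pull_iff`).  Private: the public statement is `Theorems.UVOtherGroups.legsWitness_of_continuousMulEquiv`, whose module imports the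
route file and is therefore unreachable from here. [folklore] -/
private theorem legsWitness_pull (e : G ≃ₜ* H)
    (h : ∃ (r : LatticeRep H) (a : ℝ → ℝ), (∀ β, 0 < a β) ∧ Tendsto a atTop (𝓝 0) ∧ LowerBounds H r a ∧ MomentBounds6 H r a) :
    ∃ (r : LatticeRep G) (a : ℝ → ℝ), (∀ β, 0 < a β) ∧ Tendsto a atTop (𝓝 0) ∧ LowerBounds G r a ∧ MomentBounds6 G r a := by
  obtain ⟨r₂, a, ha, ha0, hlb, hmb⟩ := h
  exact ⟨pull e r₂, a, ha, ha0, (lowerBounds_pull_iff e r₂ a).2 hlb, (momentBounds6_pull_iff e r₂ a).2 hmb⟩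

end Transport

/-! ## §3 Class assembly from the three R85 pieces, stated as texts -/

/-- **Bridge input on every compact simple `G` from the three class pieces** (the common core of the R85 batch `closes`):
(i) the `SU(2)` CLASS in record form at the unit of record — for every compact simple `G ≃ₜ* SU(2)` one representation with floors ∧ ceilings at
`uRec` (in the route file: `fun G _ _ _ _ hG h => hSeam hUV G hG h`, the text of `UVSeamRec` applied to `hUV`);
(ii) the `SU(N)` CLASSES, `N ≥ 3`, as witnesses AT the matrix group (in the route file: `fun N _ hN => hWit N hN (hApex N hN)`), transported to every
`G ≃ₜ* SU(N)` by Haar transport (`pull`, `lowerBounds_pull_iff`, `momentBounds6_pull_iff`);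
(iii) the non-`SU(N)` record residual (the text of `UVNonSUNRec`, verbatim).
Trichotomy: `Nonempty (G ≃ₜ* SU(2))`, else `∃ N ≥ 2, Nonempty (G ≃ₜ* SU(N))` (then `N ≥ 3`), else (iii). [folklore; glue] -/
theorem legsWitnessAll_of_pieces
    (hSU2 : ∀ (G : Type) [Group G] [TopologicalSpace G] [IsTopologicalGroup G] [CompactSpace G],
      IsCompactSimpleLieGroup G → Nonempty (G ≃ₜ* Matrix.specialUnitaryGroup (Fin 2) ℂ) →
      letI : MeasurableSpace G := borel G; haveI : BorelSpace G := ⟨rfl⟩;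
      ∃ r : LatticeRep G, LowerBounds G r uRec ∧ MomentBounds6 G r uRec)
    (hSUN : ∀ (N : ℕ) [NeZero N], 3 ≤ N →
      ∃ (r : LatticeRep (Matrix.specialUnitaryGroup (Fin N) ℂ)) (a : ℝ → ℝ), (∀ β, 0 < a β) ∧ Tendsto a atTop (𝓝 0) ∧
        LowerBounds (Matrix.specialUnitaryGroup (Fin N) ℂ) r a ∧ MomentBounds6 (Matrix.specialUnitaryGroup (Fin N) ℂ) r a)
    (hNon : ∀ (G : Type) [Group G] [TopologicalSpace G] [IsTopologicalGroup G] [CompactSpace G],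
      IsCompactSimpleLieGroup G → (∀ N : ℕ, 2 ≤ N → IsEmpty (G ≃ₜ* Matrix.specialUnitaryGroup (Fin N) ℂ)) →
      letI : MeasurableSpace G := borel G; haveI : BorelSpace G := ⟨rfl⟩;
      ∃ (r : LatticeRep G) (a : ℝ → ℝ), (∀ β, 0 < a β) ∧ Tendsto a atTop (𝓝 0) ∧ LowerBounds G r a ∧ MomentBounds6 G r a) :
    ∀ (G : Type) [Group G] [TopologicalSpace G] [IsTopologicalGroup G] [CompactSpace G],
      IsCompactSimpleLieGroup G → letI : MeasurableSpace G := borel G; haveI : BorelSpace G := ⟨rfl⟩;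
      ∃ (r : LatticeRep G) (a : ℝ → ℝ), (∀ β, 0 < a β) ∧ Tendsto a atTop (𝓝 0) ∧ LowerBounds G r a ∧ MomentBounds6 G r a := by
  intro G _ _ _ _ hG
  letI : MeasurableSpace G := borel G
  haveI : BorelSpace G := ⟨rfl⟩
  by_cases hcl : Nonempty (G ≃ₜ* Matrix.specialUnitaryGroup (Fin 2) ℂ)
  · obtain ⟨r, hlb, hmb⟩ := hSU2 G hG hcl
    exact ⟨r, uRec, uRec_pos, tendsto_uRec, hlb, hmb⟩
  · by_cases hex : ∃ N : ℕ, 2 ≤ N ∧ Nonempty (G ≃ₜ* Matrix.specialUnitaryGroup (Fin N) ℂ)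
    · obtain ⟨N, hN2, ⟨e⟩⟩ := hex
      have hN3 : 3 ≤ N := by
        by_contra hlt
        obtain rfl : N = 2 := by omega
        exact hcl ⟨e⟩
      haveI : NeZero N := ⟨by omega⟩
      exact legsWitness_pull e (hSUN N hN3)
    · exact hNon G hG (fun N hN => ⟨fun e => hex ⟨N, hN, ⟨e⟩⟩⟩)

/-- The same with the `SU(2)` class given at an ARBITRARY positive unit `u → 0` (unit-generic form; `u = uRec` above). [folklore; glue] -/
theorem legsWitnessAll_of_pieces_at (u : ℝ → ℝ) (hu : ∀ β, 0 < u β) (hu0 : Tendsto u atTop (𝓝 0))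
    (hSU2 : ∀ (G : Type) [Group G] [TopologicalSpace G] [IsTopologicalGroup G] [CompactSpace G],
      IsCompactSimpleLieGroup G → Nonempty (G ≃ₜ* Matrix.specialUnitaryGroup (Fin 2) ℂ) →
      letI : MeasurableSpace G := borel G; haveI : BorelSpace G := ⟨rfl⟩;
      ∃ r : LatticeRep G, LowerBounds G r u ∧ MomentBounds6 G r u)
    (hSUN : ∀ (N : ℕ) [NeZero N], 3 ≤ N →
      ∃ (r : LatticeRep (Matrix.specialUnitaryGroup (Fin N) ℂ)) (a : ℝ → ℝ), (∀ β, 0 < a β) ∧ Tendsto a atTop (𝓝 0) ∧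
        LowerBounds (Matrix.specialUnitaryGroup (Fin N) ℂ) r a ∧ MomentBounds6 (Matrix.specialUnitaryGroup (Fin N) ℂ) r a)
    (hNon : ∀ (G : Type) [Group G] [TopologicalSpace G] [IsTopologicalGroup G] [CompactSpace G],
      IsCompactSimpleLieGroup G → (∀ N : ℕ, 2 ≤ N → IsEmpty (G ≃ₜ* Matrix.specialUnitaryGroup (Fin N) ℂ)) →
      letI : MeasurableSpace G := borel G; haveI : BorelSpace G := ⟨rfl⟩;
      ∃ (r : LatticeRep G) (a : ℝ → ℝ), (∀ β, 0 < a β) ∧ Tendsto a atTop (𝓝 0) ∧ LowerBounds G r a ∧ MomentBounds6 G r a) :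
    ∀ (G : Type) [Group G] [TopologicalSpace G] [IsTopologicalGroup G] [CompactSpace G],
      IsCompactSimpleLieGroup G → letI : MeasurableSpace G := borel G; haveI : BorelSpace G := ⟨rfl⟩;
      ∃ (r : LatticeRep G) (a : ℝ → ℝ), (∀ β, 0 < a β) ∧ Tendsto a atTop (𝓝 0) ∧ LowerBounds G r a ∧ MomentBounds6 G r a := by
  intro G _ _ _ _ hG
  letI : MeasurableSpace G := borel G
  haveI : BorelSpace G := ⟨rfl⟩
  by_cases hcl : Nonempty (G ≃ₜ* Matrix.specialUnitaryGroup (Fin 2) ℂ)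
  · obtain ⟨r, hlb, hmb⟩ := hSU2 G hG hcl
    exact ⟨r, u, hu, hu0, hlb, hmb⟩
  · by_cases hex : ∃ N : ℕ, 2 ≤ N ∧ Nonempty (G ≃ₜ* Matrix.specialUnitaryGroup (Fin N) ℂ)
    · obtain ⟨N, hN2, ⟨e⟩⟩ := hex
      have hN3 : 3 ≤ N := by
        by_contra hlt
        obtain rfl : N = 2 := by omega
        exact hcl ⟨e⟩
      haveI : NeZero N := ⟨by omega⟩
      exact legsWitness_pull e (hSUN N hN3)
    · exact hNon G hG (fun N hN => ⟨fun e => hex ⟨N, hN, ⟨e⟩⟩⟩)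

/-! ## §4 Closers: bridge input + `IR` + `ROT` ⊢ `YangMills` -/

/-- **`YangMills` from the bridge's UV-side input, the infrared leg and the rotation leg OF RECORD (rev 2′)**: for every compact simple `G` a
witness `(r, a)` with floors ∧ ceilings; the text of `IR` gives `GapInUnits G r a`; `Theorems.ROT.ROTRev2'` gives an unbounded torus class carrying
the rotation-Ward leg; the PROVED class bridge `Theorems.ROT.yangMills_of_legs_on` concludes.  In the route file after the R85 restate:
`hROT : ROT` unfolds to `ROTRev2'` (character-identical texts). [folklore; glue] -/
theorem yangMills_of_legsWitnessAll_rotRev2'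
    (hLegs : ∀ (G : Type) [Group G] [TopologicalSpace G] [IsTopologicalGroup G] [CompactSpace G],
      IsCompactSimpleLieGroup G → letI : MeasurableSpace G := borel G; haveI : BorelSpace G := ⟨rfl⟩;
      ∃ (r : LatticeRep G) (a : ℝ → ℝ), (∀ β, 0 < a β) ∧ Tendsto a atTop (𝓝 0) ∧ LowerBounds G r a ∧ MomentBounds6 G r a)
    (hIR : ∀ (G : Type) [Group G] [TopologicalSpace G] [IsTopologicalGroup G] [CompactSpace G],
      IsCompactSimpleLieGroup G → letI : MeasurableSpace G := borel G; haveI : BorelSpace G := ⟨rfl⟩;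
      ∀ (r : LatticeRep G) (a : ℝ → ℝ), (∀ β, 0 < a β) → Tendsto a atTop (𝓝 0) → LowerBounds G r a → GapInUnits G r a)
    (hROT : ROTRev2') : YangMills := by
  refine yangMills_of_legs_on ?_
  intro G _ _ _ _ hG
  letI : MeasurableSpace G := borel G
  haveI : BorelSpace G := ⟨rfl⟩
  obtain ⟨r, a, ha, ha0, hlb, hmb⟩ := hLegs G hG
  have hir := hIR G hG r a ha ha0 hlb
  obtain ⟨S, hS, hW⟩ := hROT G hG r a ha ha0 hlb hmb hir
  exact ⟨r, a, ha, ha0, hmb, hlb, hir, S, hS, hW⟩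

/-- **The same for the rotation leg as filed TODAY (rev 1, `Theorems.ROT.ROTRev1`)**, through the all-schemes bridge
`Y2Bridge.yangMills_of_legs` — today's `closes` body generalised from two classes to the bridge input. [folklore; glue] -/
theorem yangMills_of_legsWitnessAll_rotRev1
    (hLegs : ∀ (G : Type) [Group G] [TopologicalSpace G] [IsTopologicalGroup G] [CompactSpace G],
      IsCompactSimpleLieGroup G → letI : MeasurableSpace G := borel G; haveI : BorelSpace G := ⟨rfl⟩;
      ∃ (r : LatticeRep G) (a : ℝ → ℝ), (∀ β, 0 < a β) ∧ Tendsto a atTop (𝓝 0) ∧ LowerBounds G r a ∧ MomentBounds6 G r a)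
    (hIR : ∀ (G : Type) [Group G] [TopologicalSpace G] [IsTopologicalGroup G] [CompactSpace G],
      IsCompactSimpleLieGroup G → letI : MeasurableSpace G := borel G; haveI : BorelSpace G := ⟨rfl⟩;
      ∀ (r : LatticeRep G) (a : ℝ → ℝ), (∀ β, 0 < a β) → Tendsto a atTop (𝓝 0) → LowerBounds G r a → GapInUnits G r a)
    (hROT : ROTRev1) : YangMills := by
  refine Summit.QuantumFields.YangMills.Cruxes.OSLegsAtWeakCouplingC.Y2Bridge.yangMills_of_legs ?_
  intro G _ _ _ _ hG
  letI : MeasurableSpace G := borel G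
  haveI : BorelSpace G := ⟨rfl⟩
  obtain ⟨r, a, ha, ha0, hlb, hmb⟩ := hLegs G hG
  exact ⟨r, a, ha, ha0, hmb, hlb, hIR G hG r a ha ha0 hlb, hROT G hG r a ha ha0 hlb hmb⟩

/-- **THE R85 BATCH `closes` OF RECORD, as a cycle-free composition** (= the owner's `closes_R85'` modulo the two lambdas that read the route
decls): the `SU(2)`-class record piece at `uRec` (`hSeam hUV`), the `SU(N)` witnesses `N ≥ 3` (`hWit N hN (hApex N hN)`), the non-`SU(N)` record
residual (`hNon`), the infrared leg (`hIR`) and the rotation leg rev 2′ (`hROT`) give `_root_.YangMills`.  Seven binders upstream, five here;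
nothing is discharged. [folklore; glue] -/
theorem yangMills_of_pieces_rotRev2'
    (hSU2 : ∀ (G : Type) [Group G] [TopologicalSpace G] [IsTopologicalGroup G] [CompactSpace G],
      IsCompactSimpleLieGroup G → Nonempty (G ≃ₜ* Matrix.specialUnitaryGroup (Fin 2) ℂ) →
      letI : MeasurableSpace G := borel G; haveI : BorelSpace G := ⟨rfl⟩;
      ∃ r : LatticeRep G, LowerBounds G r uRec ∧ MomentBounds6 G r uRec)
    (hSUN : ∀ (N : ℕ) [NeZero N], 3 ≤ N →
      ∃ (r : LatticeRep (Matrix.specialUnitaryGroup (Fin N) ℂ)) (a : ℝ → ℝ), (∀ β, 0 < a β) ∧ Tendsto a atTop (𝓝 0) ∧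
        LowerBounds (Matrix.specialUnitaryGroup (Fin N) ℂ) r a ∧ MomentBounds6 (Matrix.specialUnitaryGroup (Fin N) ℂ) r a)
    (hNon : ∀ (G : Type) [Group G] [TopologicalSpace G] [IsTopologicalGroup G] [CompactSpace G],
      IsCompactSimpleLieGroup G → (∀ N : ℕ, 2 ≤ N → IsEmpty (G ≃ₜ* Matrix.specialUnitaryGroup (Fin N) ℂ)) →
      letI : MeasurableSpace G := borel G; haveI : BorelSpace G := ⟨rfl⟩;
      ∃ (r : LatticeRep G) (a : ℝ → ℝ), (∀ β, 0 < a β) ∧ Tendsto a atTop (𝓝 0) ∧ LowerBounds G r a ∧ MomentBounds6 G r a)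
    (hIR : ∀ (G : Type) [Group G] [TopologicalSpace G] [IsTopologicalGroup G] [CompactSpace G],
      IsCompactSimpleLieGroup G → letI : MeasurableSpace G := borel G; haveI : BorelSpace G := ⟨rfl⟩;
      ∀ (r : LatticeRep G) (a : ℝ → ℝ), (∀ β, 0 < a β) → Tendsto a atTop (𝓝 0) → LowerBounds G r a → GapInUnits G r a)
    (hROT : ROTRev2') : YangMills :=
  yangMills_of_legsWitnessAll_rotRev2' (legsWitnessAll_of_pieces hSU2 hSUN hNon) hIR hROT

/-- The same composition with the rotation leg as filed today (rev 1). [folklore; glue] -/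
theorem yangMills_of_pieces_rotRev1
    (hSU2 : ∀ (G : Type) [Group G] [TopologicalSpace G] [IsTopologicalGroup G] [CompactSpace G],
      IsCompactSimpleLieGroup G → Nonempty (G ≃ₜ* Matrix.specialUnitaryGroup (Fin 2) ℂ) →
      letI : MeasurableSpace G := borel G; haveI : BorelSpace G := ⟨rfl⟩;
      ∃ r : LatticeRep G, LowerBounds G r uRec ∧ MomentBounds6 G r uRec)
    (hSUN : ∀ (N : ℕ) [NeZero N], 3 ≤ N →
      ∃ (r : LatticeRep (Matrix.specialUnitaryGroup (Fin N) ℂ)) (a : ℝ → ℝ), (∀ β, 0 < a β) ∧ Tendsto a atTop (𝓝 0) ∧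
        LowerBounds (Matrix.specialUnitaryGroup (Fin N) ℂ) r a ∧ MomentBounds6 (Matrix.specialUnitaryGroup (Fin N) ℂ) r a)
    (hNon : ∀ (G : Type) [Group G] [TopologicalSpace G] [IsTopologicalGroup G] [CompactSpace G],
      IsCompactSimpleLieGroup G → (∀ N : ℕ, 2 ≤ N → IsEmpty (G ≃ₜ* Matrix.specialUnitaryGroup (Fin N) ℂ)) →
      letI : MeasurableSpace G := borel G; haveI : BorelSpace G := ⟨rfl⟩;
      ∃ (r : LatticeRep G) (a : ℝ → ℝ), (∀ β, 0 < a β) ∧ Tendsto a atTop (𝓝 0) ∧ LowerBounds G r a ∧ MomentBounds6 G r a)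
    (hIR : ∀ (G : Type) [Group G] [TopologicalSpace G] [IsTopologicalGroup G] [CompactSpace G],
      IsCompactSimpleLieGroup G → letI : MeasurableSpace G := borel G; haveI : BorelSpace G := ⟨rfl⟩;
      ∀ (r : LatticeRep G) (a : ℝ → ℝ), (∀ β, 0 < a β) → Tendsto a atTop (𝓝 0) → LowerBounds G r a → GapInUnits G r a)
    (hROT : ROTRev1) : YangMills :=
  yangMills_of_legsWitnessAll_rotRev1 (legsWitnessAll_of_pieces hSU2 hSUN hNon) hIR hROT

/-! ## §5 The FALLBACK rotation shape (rev 2: infrared guard, all schemes) — appended 2026-08-27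

The owner's batch keeps `closes_R85` (item 3 in rev-2 shape: the rev-1 text with the infrared guard `GapInUnits G r a` threaded before
`LatticeRotWard G r a`, `S = univ`) as the fallback if the rev-2′ restate bounces (R85-BATCH-EDITS rev 3e item 3, FALLBACK).  Its tree twins
(`Theorems.ROT.closes_of_rotIR` in `…ROTGuardIR`, `Theorems.UVOtherGroups.yangMills_of_recordSplit_rotIR` in `…UVOtherGroupsClasses`) live in
modules importing the route file; the cycle-free closers are these, through the all-schemes bridge `Y2Bridge.yangMills_of_legs`. -/

/-- **`YangMills` from the bridge input, the infrared leg and the rotation leg in rev-2 shape** (infrared guard, all admissible schemes):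
the text `… → LowerBounds G r a → MomentBounds6 G r a → GapInUnits G r a → LatticeRotWard G r a` is the `hROT` binder of the owner's fallback
`closes_R85` verbatim. [folklore; glue] -/
theorem yangMills_of_legsWitnessAll_rotRev2
    (hLegs : ∀ (G : Type) [Group G] [TopologicalSpace G] [IsTopologicalGroup G] [CompactSpace G],
      IsCompactSimpleLieGroup G → letI : MeasurableSpace G := borel G; haveI : BorelSpace G := ⟨rfl⟩;
      ∃ (r : LatticeRep G) (a : ℝ → ℝ), (∀ β, 0 < a β) ∧ Tendsto a atTop (𝓝 0) ∧ LowerBounds G r a ∧ MomentBounds6 G r a)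
    (hIR : ∀ (G : Type) [Group G] [TopologicalSpace G] [IsTopologicalGroup G] [CompactSpace G],
      IsCompactSimpleLieGroup G → letI : MeasurableSpace G := borel G; haveI : BorelSpace G := ⟨rfl⟩;
      ∀ (r : LatticeRep G) (a : ℝ → ℝ), (∀ β, 0 < a β) → Tendsto a atTop (𝓝 0) → LowerBounds G r a → GapInUnits G r a)
    (hROT : ∀ (G : Type) [Group G] [TopologicalSpace G] [IsTopologicalGroup G] [CompactSpace G],
      IsCompactSimpleLieGroup G → letI : MeasurableSpace G := borel G; haveI : BorelSpace G := ⟨rfl⟩;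
      ∀ (r : LatticeRep G) (a : ℝ → ℝ), (∀ β, 0 < a β) → Tendsto a atTop (𝓝 0) →
        LowerBounds G r a → MomentBounds6 G r a → GapInUnits G r a →
        Summit.QuantumFields.YangMills.Cruxes.OSLegsAtWeakCouplingC.Y2Bridge.LatticeRotWard G r a) :
    YangMills := by
  refine Summit.QuantumFields.YangMills.Cruxes.OSLegsAtWeakCouplingC.Y2Bridge.yangMills_of_legs ?_
  intro G _ _ _ _ hG
  letI : MeasurableSpace G := borel G
  haveI : BorelSpace G := ⟨rfl⟩
  obtain ⟨r, a, ha, ha0, hlb, hmb⟩ := hLegs G hG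
  have hir := hIR G hG r a ha ha0 hlb
  exact ⟨r, a, ha, ha0, hmb, hlb, hir, hROT G hG r a ha ha0 hlb hmb hir⟩

/-- **The fallback batch `closes_R85` as a cycle-free composition** (items 2 in record form + item 3 in rev-2 shape): five binders here, seven upstream;
= the owner's `closes_R85` ∕ the tree twin `Theorems.UVOtherGroups.yangMills_of_recordSplit_rotIR` modulo the two lambdas reading the route decls. [folklore; glue] -/
theorem yangMills_of_pieces_rotRev2
    (hSU2 : ∀ (G : Type) [Group G] [TopologicalSpace G] [IsTopologicalGroup G] [CompactSpace G],
      IsCompactSimpleLieGroup G → Nonempty (G ≃ₜ* Matrix.specialUnitaryGroup (Fin 2) ℂ) →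
      letI : MeasurableSpace G := borel G; haveI : BorelSpace G := ⟨rfl⟩;
      ∃ r : LatticeRep G, LowerBounds G r uRec ∧ MomentBounds6 G r uRec)
    (hSUN : ∀ (N : ℕ) [NeZero N], 3 ≤ N →
      ∃ (r : LatticeRep (Matrix.specialUnitaryGroup (Fin N) ℂ)) (a : ℝ → ℝ), (∀ β, 0 < a β) ∧ Tendsto a atTop (𝓝 0) ∧
        LowerBounds (Matrix.specialUnitaryGroup (Fin N) ℂ) r a ∧ MomentBounds6 (Matrix.specialUnitaryGroup (Fin N) ℂ) r a)
    (hNon : ∀ (G : Type) [Group G] [TopologicalSpace G] [IsTopologicalGroup G] [CompactSpace G],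
      IsCompactSimpleLieGroup G → (∀ N : ℕ, 2 ≤ N → IsEmpty (G ≃ₜ* Matrix.specialUnitaryGroup (Fin N) ℂ)) →
      letI : MeasurableSpace G := borel G; haveI : BorelSpace G := ⟨rfl⟩;
      ∃ (r : LatticeRep G) (a : ℝ → ℝ), (∀ β, 0 < a β) ∧ Tendsto a atTop (𝓝 0) ∧ LowerBounds G r a ∧ MomentBounds6 G r a)
    (hIR : ∀ (G : Type) [Group G] [TopologicalSpace G] [IsTopologicalGroup G] [CompactSpace G],
      IsCompactSimpleLieGroup G → letI : MeasurableSpace G := borel G; haveI : BorelSpace G := ⟨rfl⟩;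
      ∀ (r : LatticeRep G) (a : ℝ → ℝ), (∀ β, 0 < a β) → Tendsto a atTop (𝓝 0) → LowerBounds G r a → GapInUnits G r a)
    (hROT : ∀ (G : Type) [Group G] [TopologicalSpace G] [IsTopologicalGroup G] [CompactSpace G],
      IsCompactSimpleLieGroup G → letI : MeasurableSpace G := borel G; haveI : BorelSpace G := ⟨rfl⟩;
      ∀ (r : LatticeRep G) (a : ℝ → ℝ), (∀ β, 0 < a β) → Tendsto a atTop (𝓝 0) →
        LowerBounds G r a → MomentBounds6 G r a → GapInUnits G r a →
        Summit.QuantumFields.YangMills.Cruxes.OSLegsAtWeakCouplingC.Y2Bridge.LatticeRotWard G r a) :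
    YangMills :=
  yangMills_of_legsWitnessAll_rotRev2 (legsWitnessAll_of_pieces hSU2 hSUN hNon) hIR hROT

end Summit.QuantumFields.YangMills.Theorems.BalabanLadderGlue

end
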